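import Summits.ABC.ABC.Theses.CubicResolventAllowance
import Summits.ABC.ABC.Theorems.CubicResolventAllowanceResolventDiscBounds
import Summits.ABC.ABC.Theorems.CubicResolventAllowanceResolventDiscBoundsCaps
import Summits.ABC.ABC.Theorems.PlaceCountSzpiroDiscLeJHeight
import Literature.NumberTheory.NumberFields.StickelbergerDiscriminant
import Literature.NumberTheory.DiophantineGeometry.Matveev2000LinearFormsLogNumberField
import HarnessLib

/-!
# STUB-IDEAS sketch — `stub_realCubic` (crux `IndexSzpiro`, stmt-ABC-22740) · ideator k3 · GEN 10

HOME FAMILY 3 (probe the extremes).  Gen 9 closed the p-adic / field / isogeny extremes of the class; gen 10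
probes the one extreme left untouched — the INFINITE PLACE, where the real/complex cut `0 < d_K` lives — and
reads the cut back through reciprocity:

* §R  **T-A. Reciprocity reading of the cut.**  By Stickelberger (tree, proved) `d_K ≡ 0,1 (mod 4)`, so for
  `d_K` odd the SIGN of `d_K` is the parity of `#{p ≡ 3 (mod 4) : v_p(d_K) odd}`; by the parity transfer
  `Δ_min·|d_K| = □` (k1 G5 keystone / k3 g0 H3) this is `#{p ≡ 3 (mod 4) : n_p odd}`.  Hence on the
  2-unramified sector the REAL class is a PARITY COSET of the tower vector `(n_p mod 2)_p` (R4, PROVED from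
  R1-hyp + R2), never an archimedean datum a `p`-adic bound could not see — and never a datum a bound MONOTONE
  in the towers could use.  R3: every cubic field ramifies at an odd prime (Minkowski + `v₂(d_K) ≤ 3`, both in
  tree/Mathlib), so the allowance `|d_K|` always shares an odd prime with `N` (R3b, PROVED from R3a + NOS-tree).
* §J  **T-B. The ∞-place is empty for Szpiro** (dead line, recorded by name): tree
  `Theorems.minimalDiscriminantNorm_dvd_den_j_mul` (`|Δ_min| ∣ 2⁸·den(j)·N⁵`): `log⁺|j|_∞` never enters;
  the one sign-sensitive analytic tool (LFL at the real places of the totally real `L = ℚ(E[2])`, tree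
  `Dioph.matveev2000_linearFormsLog_nf`) bounds only the height-conjecture surplus `h(j) − log den(j)` at Baker
  field cost `≍ R_L` (Győry–Yu: linear in the regulator).

`lean check`: rc 0; the ONLY sorry is the body of E (`mod_four_eq_one_iff_even`, M, elementary); R2 (from E +
Stickelberger), R3a (Minkowski + 2-cap, PROVED), R3b (R3a + NOS), R4 (R1-hyp + R2) and the §M recombination are
kernel-checked here.
-/

set_option linter.dupNamespace false
set_option linter.unusedVariables false

noncomputable section

open Polynomial NumberField

namespace Summit.ABC.ABC.Cruxes.IndexSzpiro.StubIdeas3G10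

/-! ## §0 The stub (verbatim) and its mirror -/

/-- `stub_realCubic` of the registered skeleton (verbatim signature). -/
def StubRealCubic : Prop :=
  ∀ ε : ℝ, 0 < ε → ∃ C : ℝ, ∀ (W : WeierstrassCurve ℚ) [W.IsElliptic] (K : Type) [Field K] [NumberField K],
    Irreducible W.twoTorsionPolynomial.toPoly → Module.finrank ℚ K = 3 →
    (∃ θ : K, aeval θ W.twoTorsionPolynomial.toPoly = 0) → 0 < NumberField.discr K →
    (W.minimalDiscriminantNorm ℤ : ℝ) ≤ C * |(NumberField.discr K : ℝ)| * (W.conductorNorm ℤ : ℝ) ^ (6 + ε)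

/-- `stub_complexCubic` (the mirror half of the skeleton's cut). -/
def StubComplexCubic : Prop :=
  ∀ ε : ℝ, 0 < ε → ∃ C : ℝ, ∀ (W : WeierstrassCurve ℚ) [W.IsElliptic] (K : Type) [Field K] [NumberField K],
    Irreducible W.twoTorsionPolynomial.toPoly → Module.finrank ℚ K = 3 →
    (∃ θ : K, aeval θ W.twoTorsionPolynomial.toPoly = 0) → NumberField.discr K < 0 →
    (W.minimalDiscriminantNorm ℤ : ℝ) ≤ C * |(NumberField.discr K : ℝ)| * (W.conductorNorm ℤ : ℝ) ^ (6 + ε)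

/-! ## §R  T-A: the reciprocity reading of the cut -/

/-- `oddExpCount3 n = #{p ∣ n prime : p ≡ 3 (mod 4), v_p(n) odd}`. -/
def oddExpCount3 (n : ℕ) : ℕ :=
  (n.primeFactors.filter (fun p => p % 4 = 3 ∧ Odd (n.factorization p))).card

/-- **E (M, elementary).** For odd `n`: `n ≡ 1 (mod 4) ⟺ #{p ≡ 3 (4) : v_p(n) odd}` is even
(multiplicativity of the character mod 4; induction on the factorisation, `Nat.recOnPosPrimePosCoprime` /
`Nat.factorization_prod_pow_eq_self`). [folklore] -/
theorem mod_four_eq_one_iff_even (n : ℕ) (hn : Odd n) : n % 4 = 1 ↔ Even (oddExpCount3 n) := by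
  sorry

/-- **R2 (S given E; PROVED here from E + tree Stickelberger).** For a number field with ODD discriminant:
`0 < d_K ⟺ #{p ≡ 3 (mod 4) : v_p(d_K) odd}` is even.  (`d_K ≡ 1 (mod 4)` by
`Literature.NumberTheory.NumberFields.stickelberger_discr_emod_four`; `−m ≡ 1 ⟺ m ≡ 3 (mod 4)`.)
[cite: Ash2010, §2.3 Problems 1–3] -/
theorem discr_pos_iff_even_oddExpCount3 (K : Type*) [Field K] [NumberField K]
    (hodd : Odd (NumberField.discr K)) :
    0 < NumberField.discr K ↔ Even (oddExpCount3 (NumberField.discr K).natAbs) := by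
  have hS := Literature.NumberTheory.NumberFields.stickelberger_discr_emod_four K
  set d := NumberField.discr K with hd
  have hd0 : d ≠ 0 := NumberField.discr_ne_zero K
  have h1 : d % 4 = 1 := by
    rcases hS with h | h
    · exfalso
      obtain ⟨k, hk⟩ := hodd
      omega
    · exact h
  have hoddabs : Odd d.natAbs := Int.natAbs_odd.mpr hodd
  rw [← mod_four_eq_one_iff_even d.natAbs hoddabs]
  constructor
  · intro hpos
    have : (d.natAbs : ℤ) = d := Int.natAbs_of_nonneg hpos.le
    omega
  · intro hmod
    by_contra hneg
    push Not at hneg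
    have hlt : d < 0 := lt_of_le_of_ne hneg hd0
    have : (d.natAbs : ℤ) = -d := Int.ofNat_natAbs_of_nonpos hlt.le
    omega

/-- **R1 (named hypothesis = k1 G5 keystone `Δ = q²·d_K` / k3 g0 H3, sketch-proved there; typed ≠ landed).**
Parity transfer: on the class, `|Δ_min|·|d_K|` is a perfect square, i.e. `n_p ≡ v_p(d_K) (mod 2)` for every `p`
(`disc ψ₂ = 16Δ` — Mathlib `WeierstrassCurve.twoTorsionPolynomial_disc` — and `disc ψ₂ = d_K·[𝓞_K : ℤ[4θ]]²`
up to squares; minimal models change `Δ` by `u¹²`). [cite: SilvermanAEC2009, III.1 and VII.1] -/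
def ParityTransfer : Prop :=
  ∀ (W : WeierstrassCurve ℚ) [W.IsElliptic] (K : Type) [Field K] [NumberField K],
    Irreducible W.twoTorsionPolynomial.toPoly → Module.finrank ℚ K = 3 →
    (∃ θ : K, aeval θ W.twoTorsionPolynomial.toPoly = 0) →
    IsSquare (W.minimalDiscriminantNorm ℤ * (NumberField.discr K).natAbs)

/-- `towerOddCount3 W = #{p ≡ 3 (mod 4) : n_p = v_p(Δ_min) odd}` — a function of the TOWER VECTOR only. -/
def towerOddCount3 (W : WeierstrassCurve ℚ) [W.IsElliptic] : ℕ :=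
  oddExpCount3 (W.minimalDiscriminantNorm ℤ)

/-- Squares have even exponents: `IsSquare (a·b) ⇒ (Odd (v_p a) ⟺ Odd (v_p b))`. -/
theorem odd_factorization_iff_of_isSquare_mul {a b : ℕ} (ha : a ≠ 0) (hb : b ≠ 0)
    (h : IsSquare (a * b)) (p : ℕ) : Odd (a.factorization p) ↔ Odd (b.factorization p) := by
  obtain ⟨r, hr⟩ := h
  have hr0 : r ≠ 0 := by
    rintro rfl
    simp at hr
    rcases hr with h | h <;> contradiction
  have hsum : a.factorization p + b.factorization p = 2 * r.factorization p := by
    have := congrArg (fun m => m.factorization p) hr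
    simp only [Nat.factorization_mul ha hb, Nat.factorization_mul hr0 hr0, Finsupp.coe_add,
      Pi.add_apply] at this
    omega
  have heven : Even (a.factorization p + b.factorization p) := ⟨r.factorization p, by omega⟩
  constructor
  · intro hao
    by_contra hbe
    rw [Nat.not_odd_iff_even] at hbe
    exact (Nat.not_even_iff_odd.mpr (Odd.add_even hao hbe)) heven
  · intro hbo
    by_contra hae
    rw [Nat.not_odd_iff_even] at hae
    exact (Nat.not_even_iff_odd.mpr (Even.add_odd hae hbo)) heven

/-- The filtered sets agree when exponent parities agree. -/
theorem oddExpCount3_eq_of_isSquare_mul {a b : ℕ} (ha : a ≠ 0) (hb : b ≠ 0) (h : IsSquare (a * b)) :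
    oddExpCount3 a = oddExpCount3 b := by
  unfold oddExpCount3
  congr 1
  ext p
  simp only [Finset.mem_filter, Nat.mem_primeFactors]
  have hiff := odd_factorization_iff_of_isSquare_mul ha hb h p
  constructor
  · rintro ⟨⟨hp, hpa, -⟩, h4, hodd⟩
    have hoddb := hiff.mp hodd
    have hpb : p ∣ b := by
      by_contra hnd
      rw [Nat.factorization_eq_zero_of_not_dvd hnd] at hoddb
      exact (Nat.not_odd_iff_even.mpr ⟨0, rfl⟩) hoddb
    exact ⟨⟨hp, hpb, hb⟩, h4, hoddb⟩
  · rintro ⟨⟨hp, hpb, -⟩, h4, hodd⟩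
    have hodda := hiff.mpr hodd
    have hpa : p ∣ a := by
      by_contra hnd
      rw [Nat.factorization_eq_zero_of_not_dvd hnd] at hodda
      exact (Nat.not_odd_iff_even.mpr ⟨0, rfl⟩) hodda
    exact ⟨⟨hp, hpa, ha⟩, h4, hodda⟩

/-- **R4 (PROVED from R1-hyp + R2). THE CUT IS A PARITY COSET OF THE TOWER VECTOR.**  On the 2-unramified
sector (`d_K` odd) a member of the class `IndexSzpiro` is in the REAL class iff the number of primes
`p ≡ 3 (mod 4)` carrying an ODD tower `n_p` is even.  (Off the sector the same holds with the 2-adic square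
class of `Δ_min` added — a local datum at `2`.) [folklore] -/
theorem real_iff_even_towerOddCount3 (hPT : ParityTransfer) (W : WeierstrassCurve ℚ) [W.IsElliptic]
    (K : Type) [Field K] [NumberField K] (hirr : Irreducible W.twoTorsionPolynomial.toPoly)
    (hK : Module.finrank ℚ K = 3) (hθ : ∃ θ : K, aeval θ W.twoTorsionPolynomial.toPoly = 0)
    (hodd : Odd (NumberField.discr K)) :
    0 < NumberField.discr K ↔ Even (towerOddCount3 W) := by
  rw [discr_pos_iff_even_oddExpCount3 K hodd, towerOddCount3]
  have hsq := hPT W K hirr hK hθ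
  have hΔ0 : W.minimalDiscriminantNorm ℤ ≠ 0 := (WeierstrassCurve.minimalDiscriminantNorm_pos_holds W).ne'
  have hd0 : (NumberField.discr K).natAbs ≠ 0 := Int.natAbs_ne_zero.mpr (NumberField.discr_ne_zero K)
  rw [oddExpCount3_eq_of_isSquare_mul hΔ0 hd0 hsq]

/-- **R3a (PROVED). Every cubic field is ramified at an ODD prime**: otherwise `|d_K| = 2^{v₂(d_K)} ≤ 8`
(tree `padicValNat_two_discr_le_three`), contradicting Minkowski `|d_K| ≥ 3⁶/((4/π)^{2r₂}·36) > 11`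
(Mathlib `NumberField.abs_discr_ge'`, `r₂ ≤ 1`, `π > 3`). [cite: NeukirchANT1999, Ch. III (2.6) and (2.14)] -/
theorem exists_odd_prime_dvd_discr (K : Type*) [Field K] [NumberField K] (hK : Module.finrank ℚ K = 3) :
    ∃ p : ℕ, p.Prime ∧ p ≠ 2 ∧ p ∣ (NumberField.discr K).natAbs := by
  by_contra hcon
  push Not at hcon
  have hD0 : (NumberField.discr K).natAbs ≠ 0 := Int.natAbs_ne_zero.mpr (NumberField.discr_ne_zero K)
  -- Step 1: `|d_K|` is a power of `2`, hence `≤ 8` by the tame/wild cap `v₂(d_K) ≤ 3`.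
  have huniq : ∀ {d : ℕ}, d.Prime → d ∣ (NumberField.discr K).natAbs → d = 2 := by
    intro d hd hdD
    by_contra h2
    exact hcon d hd h2 hdD
  obtain ⟨k, hk⟩ : ∃ k : ℕ, (NumberField.discr K).natAbs = 2 ^ k :=
    ⟨_, Nat.eq_prime_pow_of_unique_prime_dvd hD0 huniq⟩
  have hv := Summit.ABC.ABC.Theorems.padicValNat_two_discr_le_three K hK.le
  rw [hk, padicValNat.prime_pow] at hv
  have hDle : (NumberField.discr K).natAbs ≤ 8 := by
    calc (NumberField.discr K).natAbs = 2 ^ k := hk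
      _ ≤ 2 ^ 3 := Nat.pow_le_pow_right (by norm_num) hv
      _ = 8 := by norm_num
  have hDR : ((|NumberField.discr K| : ℤ) : ℝ) ≤ 8 := by
    rw [← Int.natCast_natAbs]
    exact_mod_cast hDle
  -- Step 2: Minkowski, `n = 3`, `r₂ ≤ 1`, `π > 3`: `|d_K| ≥ 729/(36·(4/π)^{2r₂}) ≥ 729·9/(36·16) > 11`.
  have hM := NumberField.abs_discr_ge' K
  rw [hK] at hM
  have hr2 : NumberField.InfinitePlace.nrComplexPlaces K ≤ 1 := by
    have := NumberField.InfinitePlace.card_add_two_mul_card_eq_rank K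
    rw [hK] at this
    omega
  have h4pi : 1 ≤ 4 / Real.pi := by
    rw [le_div_iff₀ Real.pi_pos]; linarith [Real.pi_lt_four]
  set A := (4 / Real.pi) ^ (2 * NumberField.InfinitePlace.nrComplexPlaces K) with hA
  have hA1 : A ≤ 16 / 9 := by
    calc A ≤ (4 / Real.pi) ^ 2 := pow_le_pow_right₀ h4pi (by omega)
      _ ≤ (4 / 3) ^ 2 := by
          apply pow_le_pow_left₀ (by positivity)
          exact div_le_div_of_nonneg_left (by norm_num) (by norm_num) Real.pi_gt_three.le
      _ = 16 / 9 := by norm_num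
  have hApos : 0 < A := by positivity
  have h729 : ((3 : ℕ) : ℝ) ^ (2 * 3) = 729 := by norm_num
  have h36 : (((3 : ℕ).factorial : ℕ) : ℝ) ^ 2 = 36 := by norm_num [Nat.factorial]
  rw [h729, h36] at hM
  have h8 : (729 : ℝ) / (A * 36) ≤ 8 := hM.trans hDR
  rw [div_le_iff₀ (by positivity)] at h8
  nlinarith [hA1, hApos]

/-- **R3b (PROVED from R3a + tree NOS). The allowance always meets the conductor at an odd prime**:
in the class, some odd `p` divides both `d_K` and `N` (`K = ℚ(θ) ↪ ℚ(E[2])`, `d_K ∣ d_{ℚ(E[2])}`,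
`not_dvd_discr_divisionField_two`).  So `|d_K|` is never a power of `2`, never coprime to `N_odd`; the
extreme «allowance degenerate» does not exist (for scale: the smallest totally real cubic discriminant is `49`).
[cite: SilvermanAEC2009, Thm. VII.7.1] -/
theorem exists_odd_prime_dvd_discr_dvd_conductor (W : WeierstrassCurve ℚ) [W.IsElliptic]
    (K : Type) [Field K] [NumberField K] (hirr : Irreducible W.twoTorsionPolynomial.toPoly)
    (hK : Module.finrank ℚ K = 3) (hθ : ∃ θ : K, aeval θ W.twoTorsionPolynomial.toPoly = 0) :
    ∃ p : ℕ, p.Prime ∧ p ≠ 2 ∧ p ∣ (NumberField.discr K).natAbs ∧ p ∣ W.conductorNorm ℤ := by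
  obtain ⟨p, hp, hp2, hpd⟩ := exists_odd_prime_dvd_discr K hK
  refine ⟨p, hp, hp2, hpd, ?_⟩
  by_contra hpN
  obtain ⟨θ, hθ⟩ := hθ
  have hint : IsIntegral ℚ θ := IsIntegral.of_finite ℚ θ
  have hdvd : minpoly ℚ θ ∣ W.twoTorsionPolynomial.toPoly := minpoly.dvd ℚ θ hθ
  have hassoc := (minpoly.irreducible hint).associated_of_dvd hirr hdvd
  have hdeg : (minpoly ℚ θ).natDegree = 3 := by
    rw [Polynomial.natDegree_eq_of_degree_eq (Polynomial.degree_eq_degree_of_associated hassoc)]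
    exact Cubic.natDegree_of_a_ne_zero (by norm_num [WeierstrassCurve.twoTorsionPolynomial])
  have hgen : IntermediateField.adjoin ℚ {θ} = ⊤ :=
    (Field.primitive_element_iff_minpoly_natDegree_eq ℚ θ).mpr (by rw [hdeg, hK])
  obtain ⟨ψ⟩ := Summit.ABC.ABC.Theorems.exists_ringHom_divisionField_two W K hθ hgen
  haveI := Summit.ABC.ABC.Theorems.numberField_divisionField_two W
  letI : Algebra K (W.divisionField 2) := ψ.toAlgebra
  have hKD : NumberField.discr K ∣ NumberField.discr (W.divisionField 2) :=
    NumberField.discr_dvd_discr K (W.divisionField 2)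
  have hnd := Summit.ABC.ABC.Theorems.not_dvd_discr_divisionField_two W hp hp2 hpN
  exact hnd ((Int.natCast_dvd.mpr hpd).trans hKD)

/-! ## §J  T-B: the infinite place is empty for Szpiro (names pinned, nothing new claimed) -/

/-- Tree, landed (route PlaceCountSzpiro): `|Δ_min| ∣ 2⁸·den(j)·N⁵` — the stub's LHS is the p-adic polar
divisor of `j` up to the additive rung; `log⁺|j|_∞` and the sign of `Δ` do not occur. -/
example (W : WeierstrassCurve ℚ) [W.IsElliptic] :
    W.minimalDiscriminantNorm ℤ ∣ 2 ^ 8 * (W.j).den * W.conductorNorm ℤ ^ 5 :=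
  Summit.ABC.ABC.Theorems.minimalDiscriminantNorm_dvd_den_j_mul W

/-- Tree, named fact (hypothesis only): Matveev over number fields — the one analytic input that reads the
real embeddings of the totally real `L = ℚ(E[2])`; it bounds `log⁺|j|_∞`, which Szpiro discards. -/
example : Prop := Literature.NumberTheory.DiophantineGeometry.Dioph.matveev2000_linearFormsLog_nf

/-! ## §M  The merge recommendation, typed (k2 g7 R1 restated with the reason R4) -/

/-- The skeleton's cut recombines trivially; R4 says no tower-monotone argument separates the halves. -/
theorem indexSzpiro_both_signs_of (hR : StubRealCubic) (hC : StubComplexCubic) :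
    ∀ ε : ℝ, 0 < ε → ∃ C : ℝ, ∀ (W : WeierstrassCurve ℚ) [W.IsElliptic] (K : Type) [Field K] [NumberField K],
      Irreducible W.twoTorsionPolynomial.toPoly → Module.finrank ℚ K = 3 →
      (∃ θ : K, aeval θ W.twoTorsionPolynomial.toPoly = 0) →
      (W.minimalDiscriminantNorm ℤ : ℝ) ≤ C * |(NumberField.discr K : ℝ)| * (W.conductorNorm ℤ : ℝ) ^ (6 + ε) := by
  intro ε hε
  obtain ⟨C₁, h₁⟩ := hR ε hε
  obtain ⟨C₂, h₂⟩ := hC ε hε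
  refine ⟨max C₁ C₂, fun W _ K _ _ hirr hK hθ => ?_⟩
  have hd0 : NumberField.discr K ≠ 0 := NumberField.discr_ne_zero K
  have hnn : 0 ≤ |(NumberField.discr K : ℝ)| * (W.conductorNorm ℤ : ℝ) ^ (6 + ε) := by positivity
  rcases lt_or_gt_of_ne hd0 with hneg | hpos
  · calc (W.minimalDiscriminantNorm ℤ : ℝ) ≤ C₂ * |(NumberField.discr K : ℝ)| * (W.conductorNorm ℤ : ℝ) ^ (6 + ε) :=
          h₂ W K hirr hK hθ hneg
      _ ≤ max C₁ C₂ * |(NumberField.discr K : ℝ)| * (W.conductorNorm ℤ : ℝ) ^ (6 + ε) := by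
          rw [mul_assoc, mul_assoc]; exact mul_le_mul_of_nonneg_right (le_max_right _ _) hnn
  · calc (W.minimalDiscriminantNorm ℤ : ℝ) ≤ C₁ * |(NumberField.discr K : ℝ)| * (W.conductorNorm ℤ : ℝ) ^ (6 + ε) :=
          h₁ W K hirr hK hθ hpos
      _ ≤ max C₁ C₂ * |(NumberField.discr K : ℝ)| * (W.conductorNorm ℤ : ℝ) ^ (6 + ε) := by
          rw [mul_assoc, mul_assoc]; exact mul_le_mul_of_nonneg_right (le_max_left _ _) hnn

end Summit.ABC.ABC.Cruxes.IndexSzpiro.StubIdeas3G10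

end
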